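import Summits.BirchSwinnertonDyer.Rank1Residual.X2.EisensteinCongruenceOfFacts
import Summits.BirchSwinnertonDyer.Rank1Residual.X2.GreenbergVatsalInputsOfFacts
import Summits.BirchSwinnertonDyer.Rank1Residual.X2.GreenbergVatsalThm13GoodOrdinary
import HarnessLib

/-!
# Class X2 (odd multiplicative Eisenstein prime): A64 / A63 / `X2.TargetA` (the X2a closure) and
# A14 (GV Thm. (1.3) in its printed setting) as terms of registered facts in which GV Thm. (3.11)
# is cited ONCE for good-ordinary-or-multiplicative `p` and every other analytic input is curve-free
# (cell `b2b-bsdres`, unit `b2b-bsdres-eisenstein-p2`, gen 21; corollary file of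
# `EisensteinCongruenceOfFacts.lean`)

HONEST FRAMING (run/shared/lean/b2b/bsd-rank1-residual/, verbatim in every file): the goal of the
cell is to DELETE the COMBINATION-SHAPED residual classes of the Birch–Swinnerton-Dyer formula for
ALL analytic-rank `≤ 1` elliptic curves over `ℚ` — "full BSD formula for every rank `≤ 1` curve in
class `C`" assembled STRICTLY from published theorems — so that the rank-`≤ 1` remainder becomes
exactly the CONSTRUCTION-SHAPED classes, which are TYPED (missing-input `Prop`s), NOT attempted.
This is not "finishing BSD". Research route; NO CLAIM BEYOND STATED CLASSES; nothing here changes a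
label. Theorems only (no definition, no named fact, nothing asserted).

## What this file proves

Gen 18 (`GreenbergVatsalInputsOfFacts`) derived A64/A63/`X2.TargetA` from registered facts including
the reading-fact A196 (`nonPrimitive_unitContent_and_lambda_eq_residual_of_lineRamifiedEven`, the
multiplicative transcription of GV Thm. (3.11)+(28)+p. 43 — carrier of the referee's flag
`GV00-mult-asserted`); gen 20 (`GreenbergVatsalThm13GoodOrdinary`) derived A14 from registered facts
including the good-ordinary twin p253710. Gen 21 (`EisensteinCongruenceOfFacts`) derived BOTH
reading-facts from the four UNFOLDED facts F0 `exists_characterLFunction` (Kubota–Leopoldt–Iwasawa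
existence), F1 `thm311_hasUnitContent_iff_and_order_eq_of_lineRamifiedEven` (GV Thm. (3.11)+(28),
ONE statement for good ordinary OR multiplicative `p` = GV's §3 standing hypothesis), F2/F3
`characterLFunction{C,D}_hasUnitContent_and_order_eq_card` (Ferrero–Washington + Mazur–Wiles +
Props. (2.6)/(2.8); curve-free). This file substitutes: the X2a facts and the printed Thm. (1.3) are
now the terms

* `lambda_muAnal_multiplicative_of_gvPar_of_unfoldedFacts` — A64 ⇐ {A40, A41, A133, A135, A137,
  A61, A195, A180, F0, F1, F2, F3};
* `lambdaMu_multiplicative_of_gvPar_of_unfoldedFacts` — A63 ⇐ the same + A33 (Wuthrich Thm. 16 at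
  `p ‖ N`);
* `targetA_of_unfoldedFacts` — `X2.TargetA` ⇐ the same + the published rank-zero inputs of gen 1/3;
* `thm13_charIdeal_eq_of_gvPar_of_unfoldedFacts` — A14 ⇐ {A111, A115, A116, A61, A195, A180, A8,
  F0, F1, F2, F3}:

in none of which a multiplicative TRANSCRIPTION of a GV statement occurs — the multiplicative-specific
inputs are the Tate uniformisation (A40/A41), the numbered §2 statements printed for general ordinary
representations (A133/A135/A137, GV Rem. (2.10)), Wuthrich's Thm. 16 at `p ‖ N` (A33), and kernel
theorems.

References: [GreenbergVatsal2000] Thm. (1.3), §2 (16), pp. 26–30, §3 p. 32, Thm. (3.11), (26)–(28),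
p. 43, Cor. (3.8); [Wuthrich2014] Thm. 16; HOME/b2b-bsdres-eisenstein-p2/X2-GAP.md §26.
-/

set_option autoImplicit false

noncomputable section

open scoped Classical AddSubgroup MatrixGroups ModularForm

open PowerSeries NumberField IsDedekindDomain Field WeierstrassCurve CongruenceSubgroup
  Literature.NumberTheory.EllipticCurves Literature.NumberTheory.EllipticCurves.GreenbergVatsal2000
  Literature.NumberTheory.EllipticCurves.ModularForms
  Literature.NumberTheory.EllipticCurves.Wuthrich2014
  Literature.NumberTheory.EllipticCurves.SteinWuthrich2013
  Literature.NumberTheory.EllipticCurves.Rank1Residual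
  Summit.BirchSwinnertonDyer.Rank1Residual.X2.GreenbergVatsalCaseTwo
  Summit.BirchSwinnertonDyer.Rank1Residual.X2.GreenbergVatsalInputsOfFacts
  Summit.BirchSwinnertonDyer.Rank1Residual.X2.GreenbergVatsalThm13GoodOrdinary
  Summit.BirchSwinnertonDyer.Rank1Residual.X2.EisensteinCongruenceOfFacts

namespace Summit.BirchSwinnertonDyer.Rank1Residual.X2.GreenbergVatsalOfUnfoldedFacts

/-- **A64 = `GreenbergVatsal2000.lambda_muAnal_multiplicative_of_gvPar` from registered facts with
the reading-fact A196 replaced by its unfolded sources** F0/F1/F2/F3 (gen 21) — via gen 18's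
`lambda_muAnal_multiplicative_of_gvPar_of_facts` and gen 21's
`nonPrimitive_unitContent_and_lambda_eq_residual_of_lineRamifiedEven_of_facts`.
[cite: GreenbergVatsal2000, Thm. (1.3), §2 (16), pp. 28–30, §3 Thm. (3.11), (28), p. 43, Cor. (3.8)]
[cite: GreenbergLNM1716, Prop. 5.10 (PDF p. 147)] -/
theorem lambda_muAnal_multiplicative_of_gvPar_of_unfoldedFacts
    (hT : Silverman1994_thmV53_tateUniformisation.{0})
    (hT' : Silverman1994_thmV53_corV54_tateUniformisation.{0})
    (hA : lambda_nonPrimitive_eq_add_sum_delta_multiplicative)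
    (hB : datumSelmer_divisible_of_finite_torsionBy)
    (hF : datumStrictSelmer_lt_datumSelmer_of_split)
    (hG : Greenberg1999.prop510_isTorsion_hasUnitContent_of_gvPar)
    (hLiftF : residualEpsilon_surjOn_of_lineRamifiedEven)
    (hP : cor38_realPeriodRat_eq_unit_mul_of_isIsogenous_of_gvPar)
    (hEx : exists_characterLFunction)
    (h311 : thm311_hasUnitContent_iff_and_order_eq_of_lineRamifiedEven)
    (hC : characterLFunctionC_hasUnitContent_and_order_eq_card)
    (hD : characterLFunctionD_hasUnitContent_and_order_eq_card) :
    lambda_muAnal_multiplicative_of_gvPar :=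
  lambda_muAnal_multiplicative_of_gvPar_of_facts hT hT' hA hB hF hG hLiftF
    (nonPrimitive_unitContent_and_lambda_eq_residual_of_lineRamifiedEven_of_facts hT hT' hEx h311
      hC hD) hP

/-- **A63 = `GreenbergVatsal2000.lambdaMu_multiplicative_of_gvPar` from registered facts with A196
unfolded** (+ Wuthrich 2014 Thm. 16 at `p ‖ N`, `hWu`).
[cite: GreenbergVatsal2000, Thm. (1.3), §2 (16), pp. 28–30, §3 Thm. (3.11), (28), p. 43, Cor. (3.8)]
[cite: Wuthrich2014, Thm. 16 (p. 397)] -/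
theorem lambdaMu_multiplicative_of_gvPar_of_unfoldedFacts
    (hT : Silverman1994_thmV53_tateUniformisation.{0})
    (hT' : Silverman1994_thmV53_corV54_tateUniformisation.{0})
    (hA : lambda_nonPrimitive_eq_add_sum_delta_multiplicative)
    (hB : datumSelmer_divisible_of_finite_torsionBy)
    (hF : datumStrictSelmer_lt_datumSelmer_of_split)
    (hG : Greenberg1999.prop510_isTorsion_hasUnitContent_of_gvPar)
    (hLiftF : residualEpsilon_surjOn_of_lineRamifiedEven)
    (hP : cor38_realPeriodRat_eq_unit_mul_of_isIsogenous_of_gvPar)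
    (hEx : exists_characterLFunction)
    (h311 : thm311_hasUnitContent_iff_and_order_eq_of_lineRamifiedEven)
    (hC : characterLFunctionC_hasUnitContent_and_order_eq_card)
    (hD : characterLFunctionD_hasUnitContent_and_order_eq_card)
    (hWu : thm16_charIdeal_dvd_multiplicative_of_reducible) :
    lambdaMu_multiplicative_of_gvPar :=
  lambdaMu_multiplicative_of_gvPar_of_facts hT hT' hA hB hF hG hLiftF
    (nonPrimitive_unitContent_and_lambda_eq_residual_of_lineRamifiedEven_of_facts hT hT' hEx h311
      hC hD) hP hWu

/-- **`X2.TargetA` (the X2a closure of record) from registered facts with A196 unfolded**: gen 18's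
`targetA_of_facts` with its `hAnF` binder discharged by gen 21's derivation.
[cite: GreenbergVatsal2000, Thm. (1.3) with pp. 1, 14–15, §3 Thm. (3.11)]
[cite: Wuthrich2014, Thm. 16 (p. 397)] [cite: SteinWuthrich2013, Thm. 6.1 (p. 20)] -/
theorem targetA_of_unfoldedFacts
    (hT : Silverman1994_thmV53_tateUniformisation.{0})
    (hT' : Silverman1994_thmV53_corV54_tateUniformisation.{0})
    (hA : lambda_nonPrimitive_eq_add_sum_delta_multiplicative)
    (hB : datumSelmer_divisible_of_finite_torsionBy)
    (hF : datumStrictSelmer_lt_datumSelmer_of_split)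
    (hG : Greenberg1999.prop510_isTorsion_hasUnitContent_of_gvPar)
    (hLiftF : residualEpsilon_surjOn_of_lineRamifiedEven)
    (hP : cor38_realPeriodRat_eq_unit_mul_of_isIsogenous_of_gvPar)
    (hEx : exists_characterLFunction)
    (h311 : thm311_hasUnitContent_iff_and_order_eq_of_lineRamifiedEven)
    (hC : characterLFunctionC_hasUnitContent_and_order_eq_card)
    (hD : characterLFunctionD_hasUnitContent_and_order_eq_card)
    (hWu : thm16_charIdeal_dvd_multiplicative_of_reducible)
    (hJs : thm61_splitMultiplicative) (hJn : thm61_nonsplitMultiplicative)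
    (hHs : exists_isSplitMultCanonical) (hHn : exists_isMultCanonical)
    (hGZK : rank_eq_analyticRank_of_analyticRank_le_one) (hmod : hasEntireLFunction_rat)
    (hpar : nonempty_modularParametrizationData)
    (hGS : ∀ (W : WeierstrassCurve ℚ) [W.IsElliptic] [W.IsGloballyMinimal] (p : ℕ) [Fact p.Prime],
      greenberg_stevens (W := W) (p := p)) :
    TargetA :=
  targetA_of_facts hT hT' hA hB hF hG hLiftF
    (nonPrimitive_unitContent_and_lambda_eq_residual_of_lineRamifiedEven_of_facts hT hT' hEx h311
      hC hD) hP hWu hJs hJn hHs hHn hGZK hmod hpar hGS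

/-- **A14 = `GreenbergVatsal2000.thm13_charIdeal_eq_of_gvPar` (GV Thm. (1.3) in its PRINTED good
ordinary setting, with Kato) from registered facts with the reading-fact p253710 replaced by its
unfolded sources** F0/F1/F2/F3 — gen 20's `thm13_charIdeal_eq_of_gvPar_of_facts` with gen 21's
`nonPrimitive_unitContent_and_lambda_eq_residual_of_lineRamifiedEven_goodOrd_of_facts`. The SAME
four analytic facts serve the printed and the multiplicative case.
[cite: GreenbergVatsal2000, Thm. (1.3), §2 (16), pp. 26–30, §3 Thm. (3.11), (28), p. 43, Cor. (3.8)]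
[cite: Wuthrich2014, Thm. 16 (p. 393)] -/
theorem thm13_charIdeal_eq_of_gvPar_of_unfoldedFacts
    (hGV : imKummer_ge_greenbergCondition_at_p) (hA : lambda_nonPrimitive_eq_add_sum_delta)
    (hB : divisible_nonPrimitiveSelmerInfty_of_mu_eq_zero)
    (hG : Greenberg1999.prop510_isTorsion_hasUnitContent_of_gvPar)
    (hLiftF : residualEpsilon_surjOn_of_lineRamifiedEven)
    (hP : cor38_realPeriodRat_eq_unit_mul_of_isIsogenous_of_gvPar)
    (hW16 : Wuthrich2014.charIdeal_dvd_padicLFunction)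
    (hEx : exists_characterLFunction)
    (h311 : thm311_hasUnitContent_iff_and_order_eq_of_lineRamifiedEven)
    (hC : characterLFunctionC_hasUnitContent_and_order_eq_card)
    (hD : characterLFunctionD_hasUnitContent_and_order_eq_card) :
    thm13_charIdeal_eq_of_gvPar :=
  thm13_charIdeal_eq_of_gvPar_of_facts hGV hA hB hG hLiftF
    (nonPrimitive_unitContent_and_lambda_eq_residual_of_lineRamifiedEven_goodOrd_of_facts hEx h311
      hC hD) hP hW16

end Summit.BirchSwinnertonDyer.Rank1Residual.X2.GreenbergVatsalOfUnfoldedFacts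

end
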